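import Summits.ResolutionOfSingularities.ResolutionOfSingularities.Theorems.HeightCutCells
import HarnessLib

/-!
# DepthLawAlgebra — decomp-res node «AntelopeCut» (lens-4 g27, critic row 157), tree file 1/5 of the node

Content VERBATIM from the decomp-res lens-4 g27 node `HOME/decomp-res-lens-4/g27/AntelopeCut.lean` (pin de2834f0 =
`parts/AntelopeCut-g27-de2834f0.lean`,
1 885 l; HOME = run/shared/lean/pub/decomp-res): its NEW PART ONLY, §71–§73 = `parts/part_new-g27-7bf105d9.lean` (40
declarations) — the carried block
l. 106–1279 (= g26/CompanionCut.lean ll. 85–1258 VERBATIM, machine diff empty) is ALREADY in the tree as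
`Theorems/CompanionAlgebra` · `CompanionHasse` ·
`CompanionPresentation` · `CompanionTransport` · `CompanionTowers` · `CompanionCutCells` ·
`MaxContactCutCompanionCut` and is imported, not repeated.
Critic: CRITIC-LEDGER row 157 (2026-08-31T00:29:39Z): DECIDED 0 · MAP 0 — BOOKED («true kernel bricks — land as
support»; the depth / height /
dimension-count axis was priced once at row 151).  Landing orders INBOX :558/:560 (lens-4 g27 landing note +
erratum, split per NEXT-g28 §4) and :566
(critic): `--kind proof --supports stmt-ResolutionOfSingularities-28338`, namespace `…Theorems.HugValuationCut`,
canonical headers; files of the node: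
`DepthLawAlgebra` · `DepthLaw` (§71 + §71b) · `AntelopeDictionary` (§72) · `DepthCutCells` (§73, cone-free cells) ·
`MaxContactCutDepthCut` (the four §73 corollaries GIVEN
31571 `MaxContactCut.NoContactHuggingTowers` BY NAME — in the Theses cone).  Aside bookkeeping (row 157 / INBOX
:566): ONE successor aside on the lens-4
column, `NoWildShallowCompanionKangarooTowers` (home `DepthCutCells`), SUPERSEDING g26's
`NoWildCompanionKangarooTowers` / g25's route aside
`HCNoWildKangarooOffDoublePointTowers` (exact hyp-free `noWildCompanionKangarooTowers_iff_g27`); the decided cell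
`NoWildDeepCompanionKangarooTowers` is a
THEOREM (`noWildDeepCompanionKangarooTowers_holds`) and is not filed; `HeightLaw.no_doublePointTower` stays.

The lens header, verbatim:

> # AntelopeCut — decomp-res-lens-4 g27 «AntelopeCut» (lens: minimal counterexample / extremal reduction)
>
> NODE OUTPUT of generation 27 on the cell's located residual `NoWildCompanionKangarooTowers` (g26 «CompanionCut», CRITIC-LEDGER
> row 154; its landing by writer g8 is IN PROGRESS — §66–§67 landed as
`Theorems/CompanionAlgebra|CompanionHasse|CompanionPresentation`
> (2026-08-31T00:09Z, through `exists_companionContactAt`), §68–§70 pending — so g26 §66–§70 are CARRIED VERBATIM below from ONE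
> source, g26/CompanionCut.lean ll. 85–1258 = the block from the dupNamespace-linter line to `end CompanionCells`;
> on landing replace the block by the tree imports; §71–§73 are NEW).  Window g27 = INBOX
> :527: NEXT DECIDED +1 = option (F) «a FINITENESS / BOUND law for companion jumps deciding a typed sub-cell of
> `NoWildCompanionKangarooTowers` by a DIFFERENT axis — Moh's bound on the residual order of the weight-`p` companion, Hauser's
> kangaroo arithmetic, Cossart–Piltant's `ω` — in kernel, UNIFORM in `p` preferred ((i*′)), with EXACT re-location + inhabitants
> both sides (say where the six `ℓ⁴`-stage `(2,4)` chains fall)».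
>
> THIS NODE = OPTION (F), IN KERNEL, ON THE DEPTH AXIS `N = |r| + shade` (exceptional order + Moh–Hauser RESIDUAL ORDER of the
> weight-`w` contact), UNIFORM IN THE WEIGHT `w` AND IN `p`, EVERY CHARACTERISTIC, EVERY FIELD:
>
> THE DEPTH LAWS (§71, scheme level, `exists_generization_of_deepPoint`, `no_successor_of_deepPointAt`, `no_deepTower`).
>  At a stage `x_j` of a forced point tower of weight `w` whose marked stalk is PRINCIPAL MODULO `𝔪^{2w}` with a weak-contact
>  presentation of DEPTH `N` — `f ∈ 𝓘 ⊆ (f) + 𝔪^{2w}`, `f − c·z^w ∈ 𝔪^N`, `c` a unit, `z ∈ 𝔪 ∖ 𝔪²` (`DeepPointAt w N`; in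
>  Hauser's bookkeeping `f = z^w + y^r g(y)`, `N = |r| + ord g`):
>  (L-A) `N ≥ 2w`, `w ≥ 1` ⟹ NO SUCCESSOR OF RING DIMENSION ≥ 3: in the round chart (`E_y = (t)`, `z = t z'`, `f = t^w w₀`)
>    `w₀ = c·z'^w + t^w·b`, a minimal prime `P ⊇ (t, z')` has height ≤ 2 `< dim 𝒪_y` and `𝓘'_y = (π^*𝓘 : t^w) ⊆ (w₀,
t^w) ⊆ P^w` —
>    THE WHOLE EXCEPTIONAL HYPERSURFACE `E ∩ V(z')` OF THE CONTACT HYPERSURFACE LIES IN `Sing(𝓘', w)`: `y` is not isolated;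
>  (L-B) `N ≥ 2w − 1`, `w ≥ 2` ⟹ NO SUCCESSOR OF RING DIMENSION ≥ 4: `w₀ = c·z'^w + t^{w−1}·b` forces `b ∈ 𝔪_y` (else
>    `t^{w−1} ∈ 𝔪_y^w`, `t ∈ 𝔪_y²`: order is a valuation on the regular `𝒪_y`), `P ⊇ (t, z', b)` of height ≤ 3, `w₀ ∈ P^w`.
>    g25's weight-two height law IS (L-B) at `w = 2` (`doublePointAt_iff_deepPointAt : DoublePointAt ↔ DeepPointAt 2 3 := Iff.rfl`,
>    `no_doublePointTower_of_depthLaw`) — the first instance of a law uniform in the weight.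
>  COROLLARY — THE FORCED-TOWER DEPTH BOUND (`no_deepTower`, every `n ≥ 2`): along a forced tower, every principal weak-contact
>    stage has depth `N ≤ 2n − 1` before a threefold point and `N ≤ 2n − 2` before a fourfold point — THE RESIDUAL ORDER (SHADE)
>    OF THE WEIGHT-`n` CONTACT IS `≤ 2n − 1 − |r|` (resp. `≤ 2n − 2 − |r|`) AT EVERY CONTINUING STAGE: Moh's
stability `shade' ≤ shade + 1`
>    (tree `PointBlowup.shade_le_shade_add_one_along`) is capped outright along FORCED towers.
> THE ANTELOPE LAW (§72, the tree's polynomial model `Literature/…/PointBlowupShade|MohBound`, PROVED): Hauser's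
Kangaroo Theorem
>  condition (1) «`|r| + ord g` is a multiple of `p`» (arXiv:0811.4151 §C; Moh1987; tree
`PointBlowup.necessary_of_shadeIncreases`)
>  + `p`-power form (`N ≥ p + 1`) ⟹ an ANTELOPE (a state whose blow-up has a shade-increasing = KANGAROO point) has depth
>  `N ≥ 2p` (`two_mul_le_of_shadeIncreases`) ⟹ (K1 `isEquimultiplePoint_of_two_mul_le`) EVERY point of EVERY exceptional chart
>  above it is EQUIMULTIPLE (`isEquimultiplePoint_of_shadeIncreases`): «KANGAROO POINTS ARE NEVER ISOLATED POINTS OF THE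
>  WEIGHT-`p` LOCUS» — they never occur in forced point towers; in the forced window `p + 1 ≤ N ≤ 2p − 1` the shade is
>  NON-INCREASING at every point of every chart (`shade_step_le_of_depth_window`, `not_dvd_of_depth_window`).  Moh's
>  instability, Hauser's kangaroos, Cossart's example III.2 (curve blow-ups of the fundamental sequence follow the
point blow-up,
>  doi:10.4310/ajm.2011.v15.n3.a3 p. 365) and Hauser–Perlega's cycles (tree `ResidualOrderUnboundedUnforced`) all live on
>  UNFORCED sequences.
>
> Target ⟸ pieces (§73, all EXACT, the g27 step HYPOTHESIS-FREE):
>   `NoWildCompanionKangarooTowers`                                  [g26 located residual, carried §70; ⟸ tree aside 28338]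
>     ⟺ `NoWildDeepCompanionKangarooTowers`    — DECIDED (tag PROVED-IN-KERNEL: `noWildDeepCompanionKangarooTowers_holds`, no
>        port, no hypothesis, every field; general form `noTowerWild_deep_holds : NoTowerWild n (A ∧ DeepTower n)`
for EVERY class)
>      ∧ `NoWildShallowCompanionKangarooTowers` — THE LOCATED RESIDUAL (tag UNDECIDED · leaf IDEA-NEEDED: wild,
off-locus singular
>        class, `p`-power form, weight-`n` kangaroo-recurrent, companion-recurrent in every weight, and SHALLOW = `¬
DeepTower n`;
>        g25's clause `¬(n = 2 ∧ DoublePointTower)` ABSORBED by `deepTower_of_doublePointTower`)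
>   `noWildCompanionKangarooTowers_iff_g27` / `_iff_deep_and_shallow` (EXACT, hypothesis-free) · given 31571 by name:
>   `noWildKangarooOffDoublePointTowers_iff_g27 (h71)` · `noWildKangarooOffLocusTowers_iff_g27 (h71)` ·
>   `noWildPPowerOffLocusTowers_iff_g27 (h71)` · `noWildContactFreeOffLocusTowers_iff_g27 (h71)` (TREE ASIDE 28338 ⟺ the g27
>   residual) · up-links `noWildShallowCompanionKangarooTowers_of_g26 / _of_aside` · `noTowerWild_doublePoint_of_deep`.
>   STRICT GROWTH over g25/g26: the decided towers now include EVERY weight `n ≥ 2` (g25: `n = 2` only) and THREEFOLD successors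
>   (L-A; g25: fourfold only), e.g. every tower through a `p`-power point of depth `≥ 2p` — by §72 every tower
through an antelope.
>
> INHABITANTS.  DECIDED side (ENTRANCE profiles the laws stop): `f = z^p + u₁^{2p+1} + u₂^{3p+1} + u₃^{4p+1} ⊂ 𝔸⁴_k` (or without
>   `u₃` in `𝔸³`), `char k = p`, ANY `p`: an isolated point of `Sing(f, p)` (the Hasse derivatives `∂_{u_i} f = u_i^{kp}` force
>   `u = 0`, then `z = 0`), clean, `p`-power form, principal, depth `2p + 1 ≥ 2p`; its blow-up has `Sing(f', p) ⊇ E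
∩ V(z')` (the
>   `u₁`-chart: `f' = z'^p + u₁^{p+1}·unit`): no isolated successor — (L-A), uniform in `p`.  Fourfold-only profile (L-B):
>   `p = 3`, `z³ + u₁⁵ + u₂⁷ + u₃^{10}`, depth `5 = 2p − 1`: in the `u₂`-chart `Sing(f', 3) ⊇` the `u₃'`-axis, while in `𝔸³`
>   (drop `u₃`) the successor `z'³ + u₁'⁵u₂² + u₂⁴` IS isolated (L-B needs dimension 4; L-A is sharp at `2w − 1`).
>   RESIDUAL side: EVERY census chain — the 51 recurrent `(2,4)` chains and the 382 `(2,2)` kangO chains of T-kangO-jump live in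
>   ring dimension 3 ((L-B) void) and RECUR, so by (L-A) every continuing principal weak-contact stage has depth `≤
2n − 1` (= 7,
>   resp. 3): IN PARTICULAR THE SIX `ℓ⁴`-STAGE CHAINS FALL ON THE SHALLOW SIDE (their `ℓ⁴`-stages have `5 ≤ N ≤ 7`;
desk-fold ask
>   to census-1: report the depth profile `N_i`); and g25's delimiter (a) `z³ + u₁u₂³ + u₁u₂u₃² + u₁⁷ + u₂⁷ + u₃⁷`
(`p = 3`, depth
>   `4 = 2p − 2`, isolated fourfold successor) sits at the residual's ENTRANCE.
> COSTUME: none — no piece is the target, 31571, 28338 or E 1 by letters; the decided piece is a theorem, the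
residual differs from
>   g26's by the typed clause `¬ DeepTower n T` (bc/Probe.lean: M must-fail, V vacuity, P positive controls, `#print axioms`).
> BARRIER (honest): the laws DECIDE nothing inside the forced window `n + 1 ≤ N ≤ 2n − 1` (threefold) / `≤ 2n − 2` (fourfold);
>   there the shade is non-increasing (§72) but a non-increasing shade is not termination (the full invariant is
lexicographic), and
>   «whether it is possible in higher dimensions to always find a sequence of blowups which leads to a decrease of the residual
>   order in the long run is still unsolved» [corpus:
paper:hauser2024-resolving-surface-singularities-positive-characteristic p. 32
>   = PRIMS 60 (2024) 798]; the Hauser–Perlega cycles are unforced (tree `ResidualOrderUnboundedUnforced`: the 3-dimensional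
>   centre is permissible at every step) — a FORCED cycle would disprove resolution (HauserPerlega2019 §1).
> WHY NOVEL (problem-relative).  Nearest print: the SURFACE case — Hauser–Perlega's terminal «monomial / small residual» cases
>   (exceptional factor `y^{k p^e}`, `k ≥ 1` ⟹ `y ∈ J_a`, the CURVE `V(y, z)` is permissible) and «`ord F = p^e`:
`a` is an isolated
>   point of top(X) … dismissed» [corpus: same key p. 22 = PRIMS 788]; Hironaka's fundamental sequence / CJS blow up the
>   exceptional curves that (L-A) puts into the top locus (Cossart 2011 III.2.3.6 [corpus:
paper:cossart2011-is-there-notion-weak-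
>   maximal-contact-characteristic p. 9]); condition (1) «already appears in [Mo]» [corpus: arXiv:0811.4151 p. 6].  New here:
>   (a) the depth typed IDEAL-THEORETICALLY (principal modulo `𝔪^{2w}`, any embedding dimension, any weight) and
BOTH laws proved
>   at scheme level uniformly in `w` — (L-B)'s cofactor/valuation step and its height-3 prime are new as a statement
(g25 = `w = 2`);
>   (b) the coupling (1) + `p`-power form ⟹ depth `≥ 2p` ⟹ (L-A): kangaroo points are never isolated in the weight-`p` locus,
>   hence absent from forced point towers — not found in print (presearch: `lit search --hybrid "kangaroo point residual order
>   blowup positive characteristic purely inseparable"` → HP2024 pp. 5, 6, 32, Hauser2010 pp. 13, 17, 24,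
Cossart2011 pp. 2, 3, 12
>   [corpus], none states it; `lit vsearch "<(L-A) in prose>"` → Herrmann–Orbanz–Ikeda 1988 p. 422, Kollár 2007 p. 156 [corpus],
>   equimultiplicity generalities only; `lit galaxy search "kangaroo point|antelope point|residual order" --star all`,
>   `"kangaroo phenomenon|oblique polynomial|wild singularities" --star pdf` → no relevant hits [galaxy], 2026-08-31);
>   (c) the exact, hypothesis-free cut of the forced-tower residual with inhabitants on both sides.
>
> Imports: tree only (`Theorems/HeightCutCells`, `Theorems/MaxContactCutKangarooCut`, `Theorems/ContactFreeIsPPower`,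
> `Literature/AlgebraicGeometry/Resolution/PointBlowupMohBound` by name).  0 sorry; standard axioms (bc/Probe.lean §P guards).

## This file

§71 first part (NEW, KERNEL): THE DEPTH LAWS at ring level — `section DepthAlgebra` (pure commutative algebra: the
minimal primes over the round-chart contact data `(t, z′)` / `(t, z′, b)` of a deep / near-deep tail avoid the
maximal ideal by a Krull height count: `exists_prime_ne_maximalIdeal_of_deepTail` (L-A),
`exists_prime_ne_maximalIdeal_of_nearDeepTail` (L-B); the window arithmetic `not_dvd_of_depth_window`,
`two_mul_le_of_dvd_of_succ_le`).  Imports `HeightCutCells` only.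

[WRITER NOTE (decomp-res writer g9): file split only (tree files ≤ 400 lines); namespace, universe, sections,
section variables and every declaration
exactly as in the lens (the node's global `set_option` and the `open …Theses` line live only in the wiring file).]

(Sources: Hauser2010Kangaroo (arXiv:0811.4151 §C); Moh1987; HauserPerlega2019 §1; Hauser2024 PRIMS 60 pp. 788, 798;
Cossart2011 III.2 (doi:10.4310/ajm.2011.v15.n3.a3); CossartPiltant2008 §2; CossartPiltant2019 Prop. 2.50;
Giraud1975; Hironaka1970Additive.)
-/

noncomputable section

open CategoryTheory AlgebraicGeometry IsLocalRing
open Literature.AlgebraicGeometry.Resolution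
open Summit.ResolutionOfSingularities.ResolutionOfSingularities.Theorems
open WeakOrderReduction ForcedTowerClasses DivergentTowerClasses MonomialTowerClasses
open HugDimensionClasses HugDimensionKernels SurfaceShadowClasses SurfaceShadowKernels
open NearPointCut (SingularClass)
open AbsoluteContactClasses (IsAbsContactAt SepResidueAt diffIdeal_restrict_le stalkMap_comp_toStalk_eq_stalkHom)
open scoped BigOperators

namespace Summit.ResolutionOfSingularities.ResolutionOfSingularities.Theorems.HugValuationCut

section DepthAlgebra

variable {R : Type*} [CommRing R]

/-! ## §71 (g27 · NEW · KERNEL) THE DEPTH LAWS — «A DEEP POINT HAS NO SUCCESSOR», UNIFORM IN THE WEIGHT, EVERY CHARACTERISTIC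

THE DEPTH of a principal weak-contact stage.  At a point `x` of a forced tower of weight `w` whose marked stalk is PRINCIPAL
MODULO `𝔪_x^{2w}` with WEAK CONTACT of weight `w` — `f ∈ 𝓘_x ⊆ (f) + 𝔪_x^{2w}`, `f ≡ c·z^w (mod 𝔪_x^{w+1})`, `c` a unit,
`z ∈ 𝔪_x ∖ 𝔪_x²` — the TAIL DEPTH of the presentation `(f, z, c)` is the largest `N` with `f − c·z^w ∈ 𝔪_x^N`; in Hauser's
bookkeeping `f = z^w + y^r·g(y)` it is `N = |r| + shade` = exceptional order + RESIDUAL ORDER (Moh) of the weight-`w` contact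
(arXiv:0811.4151 §§B–C; Moh1987; HauserPerlega2019 §2).  `DeepPointAt w N 𝓘 x` types «some presentation has depth ≥ N».

LAW A (KERNEL, PROVED, every field, every characteristic, every weight `w ≥ 1`; `no_successor_of_deepPointAt`, case `inl`):
  «A POINT OF DEPTH ≥ 2w HAS NO SUCCESSOR OF RING DIMENSION ≥ 3.»  If `DeepPointAt w (2w) 𝓘_j x_j` then NO point `y ↦ x_j` of
  the blow-up with `dim 𝒪_y ≥ 3` is isolated in `Sing(𝓘_{j+1}, w)`: round chart `E_y = (t)`, `π^*z = t z'`, `π^*f = t^w w₀`,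
  `w₀ = π^*c·z'^w + t^w·b` (cancel `t^w` in `π^*(f − c z^w) ∈ (t^{2w})`); a minimal prime `P` over `(t, z')` has height ≤ 2
  `< 3 ≤ ht 𝔪_y`, and `𝓘_{j+1,y} = (π^*𝓘_x : t^w) ⊆ (w₀, t^w) ⊆ P^w`: the generization `ζ ⤳ y`, `𝔪_ζ ∩ 𝒪_y = P`, lies in
  `Sing(𝓘_{j+1}, w)` — i.e. THE WHOLE EXCEPTIONAL HYPERSURFACE `E ∩ V(z')` OF THE CONTACT HYPERSURFACE LIES IN THE TOP LOCUS.
LAW B (KERNEL, PROVED, every field, every characteristic, every weight `w ≥ 2`; case `inr`): «A POINT OF DEPTH ≥ 2w − 1 HAS NO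
  SUCCESSOR OF RING DIMENSION ≥ 4» — `w₀ = π^*c·z'^w + t^{w−1}·b` with `b ∈ 𝔪_y` (else `t^{w−1} ∈ 𝔪_y^w`, `t ∈ 𝔪_y²`: order is a
  valuation on the regular ring `𝒪_y`), `P` minimal over `(t, z', b)` of height ≤ 3 `< 4`, `w₀ ∈ P^w`.  For `w = 2` the depth
  hypothesis `N ≥ 3` IS weak contact: LAW B at `w = 2` is literally g25's weight-two height law
(`doublePointAt_iff_deepPointAt :
  DoublePointAt ↔ DeepPointAt 2 3`, `Iff.rfl`), which is thereby the first instance of a law UNIFORM IN THE WEIGHT.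
COROLLARY — THE FORCED-TOWER DEPTH BOUND (`no_deepTower`): along every forced tower of weight `n ≥ 2` over any field, EVERY
  principal weak-contact stage `x_j` has ALL its depths `N ≤ 2n − 1` if `dim 𝒪_{x_{j+1}} ≥ 3` and `N ≤ 2n − 2` if
`dim 𝒪_{x_{j+1}}
  ≥ 4`: in Moh–Hauser terms `|r| + shade ≤ 2n − 1` (resp. `≤ 2n − 2`) — THE RESIDUAL ORDER (SHADE) OF THE WEIGHT-`n` CONTACT IS
  BOUNDED BY `2n − 1 − |r|` ALONG FORCED TOWERS (the bound the window asks for, (F)/(i*′), uniform in `p`).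
THE ANTELOPE LAW (§72, Hauser's kangaroo arithmetic): a shade INCREASE at the blow-up of `x_j` (antelope → kangaroo,
  arXiv:0811.4151 §C Kangaroo Theorem (1), PROVED in the tree's polynomial model as `PointBlowup.necessary_of_shadeIncreases`)
  needs `p ∣ N`; in the `p`-power class `N ≥ p + 1`, so `N ≥ 2p` — DEEP: by LAW A the kangaroo point is NOT ISOLATED
(model face:
  `isEquimultiplePoint_of_shadeIncreases` — EVERY point of EVERY exceptional chart above an antelope is
equimultiple).  «KANGAROOS
  ARE NEVER FORCED»: along a forced tower of the principal weight-`p` class in ring dimension ≥ 3 the shade NEVER increases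
  (`not_dvd_of_depth_window` + `PointBlowup.shade_step_le_of_not_dvd` at every step): Moh's instability, Hauser's kangaroos and
  Hauser–Perlega's cycles (tree: `ResidualOrderUnboundedUnforced`) all live on UNFORCED sequences.
DELIMITERS: LAW A is sharp in `N` (depth `2w − 1`, ring dimension 3: `p = 3`, `z³ + u₁⁵ + u₂⁷ ⊂ 𝔸³` has the isolated
successor `z'³ + u₁'⁵u₂² + u₂⁴` in the `u₂`-chart; `p = 2`, `z² + u₁³ + u₂⁵` likewise — the census beds, all `d = 3`, recur with
`N ≤ 2n − 1`); LAW B is sharp in `N` (g25's delimiter (a): `p = 3`, `z³ + u₁u₂³ + u₁u₂u₃² + u₁⁷ + u₂⁷ + u₃⁷`, depth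
`4 = 2·3 − 2`,
isolated fourfold successor) and in the dimension (`z³ + u₁⁵ + u₂⁷`: depth `5 = 2w − 1`, isolated THREEFOLD successor). -/

/-- **KERNEL (PROVED, pure algebra): THE HEIGHT-TWO COUNT** (depth `≥ 2w`).  In a Noetherian local ring of dimension `≥ 3`: if
`w₀ − c·z'^w = t^a·b` with `w ≤ a` and `t, z' ∈ 𝔪`, then some prime `P ≠ 𝔪` contains `t` with `w₀ ∈ P^w` (`P` minimal over
`(t, z')` has height `≤ 2` by Krull's height theorem). (Sources: Matsumura1987 Thm. 13.5 = Mathlib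
`Ideal.height_le_card_of_mem_minimalPrimes_span_finset`.) -/
theorem exists_prime_ne_maximalIdeal_of_deepTail [IsNoetherianRing R] [IsLocalRing R] {t z' b c w₀ : R} {w a : ℕ}
    (hkey : w₀ - c * z' ^ w = t ^ a * b) (hwa : w ≤ a) (htm : t ∈ maximalIdeal R) (hz' : z' ∈ maximalIdeal R)
    (hdim : (3 : WithBot ℕ∞) ≤ ringKrullDim R) :
    ∃ P : Ideal R, P.IsPrime ∧ P ≠ maximalIdeal R ∧ t ∈ P ∧ w₀ ∈ P ^ w := by
  classical
  let s : Finset R := {t, z'}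
  have hJle : Ideal.span (s : Set R) ≤ maximalIdeal R := by
    rw [Ideal.span_le]
    intro x hx
    have hx' : x ∈ s := Finset.mem_coe.mp hx
    simp only [s, Finset.mem_insert, Finset.mem_singleton] at hx'
    rcases hx' with rfl | rfl
    · exact htm
    · exact hz'
  obtain ⟨P, hPmin, -⟩ := Ideal.exists_minimalPrimes_le hJle
  have hP : P.IsPrime := hPmin.1.1
  have hJP : Ideal.span (s : Set R) ≤ P := hPmin.1.2
  have hmem : ∀ x ∈ s, x ∈ P := fun x hx => hJP (Ideal.subset_span (Finset.mem_coe.mpr hx))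
  have htP : t ∈ P := hmem t (by simp [s])
  have hz'P : z' ∈ P := hmem z' (by simp [s])
  have hh : P.height ≤ 2 :=
    (Ideal.height_le_card_of_mem_minimalPrimes_span_finset hPmin).trans (by exact_mod_cast Finset.card_le_two)
  refine ⟨P, hP, ?_, htP, ?_⟩
  · rintro rfl
    have h3 : (3 : WithBot ℕ∞) ≤ ((maximalIdeal R).height : WithBot ℕ∞) := by
      rwa [IsLocalRing.maximalIdeal_height_eq_ringKrullDim]
    have h3' : (3 : ℕ∞) ≤ (maximalIdeal R).height := WithBot.coe_le_coe.mp (by rwa [WithBot.coe_ofNat])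
    have h32 : (3 : ℕ∞) ≤ 2 := h3'.trans hh
    exact absurd h32 (by decide)
  · have e : w₀ = c * z' ^ w + t ^ a * b := by rw [← hkey]; ring
    rw [e]
    refine add_mem (Ideal.mul_mem_left _ _ (Ideal.pow_mem_pow hz'P w)) (Ideal.mul_mem_right _ _ ?_)
    exact Ideal.pow_le_pow_right hwa (Ideal.pow_mem_pow htP a)

/-- **KERNEL (PROVED, pure algebra): THE HEIGHT-THREE COUNT** (depth `≥ 2w − 1`; g25's `exists_prime_ne_maximalIdeal_of_tail`
is `w = 2, a = 1`).  In a Noetherian local ring of dimension `≥ 4`: if `w₀ − c·z'^w = t^a·b` with `w ≤ a + 1` and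
`t, z', b ∈ 𝔪`, then some prime `P ≠ 𝔪` contains `t` with `w₀ ∈ P^w` (`P` minimal over `(t, z', b)`, height `≤ 3`).
(Sources: Matsumura1987 Thm. 13.5.) -/
theorem exists_prime_ne_maximalIdeal_of_nearDeepTail [IsNoetherianRing R] [IsLocalRing R] {t z' b c w₀ : R} {w a : ℕ}
    (hkey : w₀ - c * z' ^ w = t ^ a * b) (hwa : w ≤ a + 1) (htm : t ∈ maximalIdeal R) (hz' : z' ∈ maximalIdeal R)
    (hb : b ∈ maximalIdeal R) (hdim : (4 : WithBot ℕ∞) ≤ ringKrullDim R) :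
    ∃ P : Ideal R, P.IsPrime ∧ P ≠ maximalIdeal R ∧ t ∈ P ∧ w₀ ∈ P ^ w := by
  classical
  let s : Finset R := {t, z', b}
  have hJle : Ideal.span (s : Set R) ≤ maximalIdeal R := by
    rw [Ideal.span_le]
    intro x hx
    have hx' : x ∈ s := Finset.mem_coe.mp hx
    simp only [s, Finset.mem_insert, Finset.mem_singleton] at hx'
    rcases hx' with rfl | rfl | rfl
    · exact htm
    · exact hz'
    · exact hb
  obtain ⟨P, hPmin, -⟩ := Ideal.exists_minimalPrimes_le hJle
  have hP : P.IsPrime := hPmin.1.1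
  have hJP : Ideal.span (s : Set R) ≤ P := hPmin.1.2
  have hmem : ∀ x ∈ s, x ∈ P := fun x hx => hJP (Ideal.subset_span (Finset.mem_coe.mpr hx))
  have htP : t ∈ P := hmem t (by simp [s])
  have hz'P : z' ∈ P := hmem z' (by simp [s])
  have hbP : b ∈ P := hmem b (by simp [s])
  have hh : P.height ≤ 3 :=
    (Ideal.height_le_card_of_mem_minimalPrimes_span_finset hPmin).trans (by exact_mod_cast Finset.card_le_three)
  refine ⟨P, hP, ?_, htP, ?_⟩
  · rintro rfl
    have h4 : (4 : WithBot ℕ∞) ≤ ((maximalIdeal R).height : WithBot ℕ∞) := by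
      rwa [IsLocalRing.maximalIdeal_height_eq_ringKrullDim]
    have h4' : (4 : ℕ∞) ≤ (maximalIdeal R).height := WithBot.coe_le_coe.mp (by rwa [WithBot.coe_ofNat])
    have h43 : (4 : ℕ∞) ≤ 3 := h4'.trans hh
    exact absurd h43 (by decide)
  · have e : w₀ = c * z' ^ w + t ^ a * b := by rw [← hkey]; ring
    rw [e]
    refine add_mem (Ideal.mul_mem_left _ _ (Ideal.pow_mem_pow hz'P w)) ?_
    have h1 : t ^ a * b ∈ P ^ (a + 1) := by
      rw [pow_succ]; exact Ideal.mul_mem_mul (Ideal.pow_mem_pow htP a) hbP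
    exact Ideal.pow_le_pow_right hwa h1

/-- **arithmetic of the depth window** (Hauser's kangaroo condition (1) never met): `p + 1 ≤ N ≤ 2p − 1 ⇒ p ∤ N`. [folklore] -/
theorem not_dvd_of_depth_window {p N : ℕ} (h1 : p + 1 ≤ N) (h2 : N + 1 ≤ 2 * p) : ¬ p ∣ N := by
  rintro ⟨m, rfl⟩
  rcases Nat.lt_or_ge m 2 with hlt | hm
  · interval_cases m <;> omega
  · have h3 : p * 2 ≤ p * m := Nat.mul_le_mul_left p hm
    generalize p * m = M at *
    omega

/-- **arithmetic**: `p ∣ N` and `p + 1 ≤ N` force `2p ≤ N` — an antelope depth is deep. [folklore] -/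
theorem two_mul_le_of_dvd_of_succ_le {p N : ℕ} (h1 : p + 1 ≤ N) (h2 : p ∣ N) : 2 * p ≤ N := by
  by_contra h
  exact not_dvd_of_depth_window h1 (by omega) h2

end DepthAlgebra

end Summit.ResolutionOfSingularities.ResolutionOfSingularities.Theorems.HugValuationCut
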